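import Mathlib
import Summits.NavierStokesRegularity.NavierStokesRegularity.Theorems.TaoLadderRungTwoFlatBehindStart
import Summits.NavierStokesRegularity.NavierStokesRegularity.Theorems.TaoLadderRungTwoFlatBehindTail
import HarnessLib

/-!
# The BEHIND-ZONE HOP under ruling R54-1 — composed form with the TOP INPUT ONLY: the (B1) clause of the re-centred landing state
  from the energy-additive start (L-55a), the per-block transport (L-54b/L-54e) run for LARGE blocks only, and the
  vanishing bottom input (L-55b) (helper for the K_A♭ parent item stmt-NavierStokesRegularity-22987 `FlatGapCertificatesV2`,
  child 2A `GradedAdiabaticWakeA` of route TaoLadderRungTwoFlat; cell harvest/h2-tao-ladder, p1 g23; theory-1 g42/g43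
  ZONE-GEOMETRY-54, W-START-55, BOTTOM-EDGE-55b / LADDER §54–§55)

This module composes three landed pieces of the behind zone of the typed frame `H(n)` (`…Theorems.HopTube`) into
schedule-ready statements along ONE exact graded window flow `S` (Tao 2016 §4 vocabulary, graded mirror table on `S♭`):

* `weighted_topFlux_le` — the TOP-edge input of every landing block `[1−K−L, −K]` (bond `−K`: `v_{−K}` and the core's
  bottom carrier `a_{1−K}`) is `≤ A₁·A₀·(A₁ + ε·A₀)` from the two interface amplitudes (weight `e^{−θ′σt} ≤ 1`, clock `≤ 1`):
  theory-1's L-54e top term, cubic in the two small interface amplitudes;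
* `behindEnergyClause_hop_topInput` — **the (B1) clause after the hop with the top input only**: clock-weighted amplitude
  bound `A_eff` on the behind bonds (the rate), a top-input bound `Ē_top`, initial block energies `≤ V₀` (uniform in `L`) and
  ONE budget `e^{−μτ₁}V₀ + Ē_top(1−e^{−μτ₁})/μ ≤ a²W′` ⇒ `BehindEnergyClause K θ′ W′ (recentre S τ₁ a)`. The bottom-edge
  input of each block is paid INSIDE the proof: its size `(1+ε)Λ³·clock(−K−L)` uses only the flow's own qualitative
  a-priori bound `Λ` (field `apriori_S` of `PseudoFlowOnShift`) and vanishes with the deep clocks (`0 < ε₀`), so by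
  `behindEnergyClause_of_vanishing_bottomInput` (L-55b) it never enters the schedule;
* `behindEnergyClause_hop_closed` — the same with the START discharged by theory-1's energy-additive L-55a
  (`initial_blockEnergy_le_additive`: `V₀ = (√(W n + a_K²) + r_k/√(1−e^{−θ′}))²` from the (B1) clause of the tube state,
  its bottom-shell amplitude `a_K` and the kick `r_k`), and the top input by `weighted_topFlux_le`: the remaining inputs are
  the clock-weighted behind amplitude `A_eff` (rate), the two interface amplitudes `A₁, A₀` during the hop, and the scalar
  schedule inequality `e^{−μτ₁}(√(W n + a_K²) + r_k/√(1−e^{−θ′}))² + A₁A₀(A₁+εA₀)(1−e^{−μτ₁})/μ ≤ a²·W(n+1)`.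

HONEST FRAMING: inequalities about MODEL-lattice certificate flows (graded mirror table on `S♭`, `m = 2`); the rate input
`A_eff`, the interface amplitudes and the schedule inequality are HYPOTHESES; nothing certified; no item closed; nothing
about the Navier–Stokes equations.
-/

noncomputable section

-- the sub-problem namespace repeats the summit name by design (D-0017)
set_option linter.dupNamespace false

namespace Summit.NavierStokesRegularity.NavierStokesRegularity.Theorems.HopTube.R54

open Set Finset Literature.Analysis.FluidPDE Literature.Analysis.FluidPDE.TaoCascade MirrorPulse

/-! ## The top input (L-54e, top term) -/

/-- **The weighted TOP-edge flux of a landing block** (bond `−K`): with `|v_{−K}| ≤ A₁`, `|a_{1−K}| ≤ A₀` at time `t`,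
`0 ≤ σt`, `0 ≤ θ′`, `0 ≤ ε₀`: `e^{θ′(−K − (−K+σt))}·|T_{−K}(t)| ≤ A₁·A₀·(A₁ + ε·A₀)`.
[cite: Tao2016AveragedNS, §4 (4.1), (4.3); route TaoLadderRungTwoFlat, R54-1 / L-54e top input (cell LADDER §54.8)] -/
theorem weighted_topFlux_le {ε ε₀ θ' σ A₁ A₀ : ℝ} (hε : 0 ≤ ε) (hε₀ : 0 ≤ ε₀) (hθ : 0 ≤ θ') (K : ℕ)
    (S : Fin 2 → ℤ → ℝ → ℝ) {t : ℝ} (hσt : 0 ≤ σ * t)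
    (h1 : |S 1 (-(K : ℤ)) t| ≤ A₁) (h0 : |S 0 (-(K : ℤ) + 1) t| ≤ A₀) :
    Real.exp (θ' * ((((-(K : ℤ)) : ℤ) : ℝ) - (-(K : ℝ) + σ * t))) * |fluxT ε ε₀ S (-(K : ℤ)) t|
      ≤ A₁ * A₀ * (A₁ + ε * A₀) := by
  have hA₁ : 0 ≤ A₁ := (abs_nonneg _).trans h1
  have hA₀ : 0 ≤ A₀ := (abs_nonneg _).trans h0
  have hw : Real.exp (θ' * ((((-(K : ℤ)) : ℤ) : ℝ) - (-(K : ℝ) + σ * t))) ≤ 1 := by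
    rw [Real.exp_le_one_iff]
    apply mul_nonpos_of_nonneg_of_nonpos hθ
    push_cast
    linarith
  have hc1 : clock ε₀ (-(K : ℤ)) ≤ 1 := by
    unfold clock
    apply Real.rpow_le_one_of_one_le_of_nonpos (by linarith)
    have : ((-(K : ℤ) : ℤ) : ℝ) ≤ 0 := by exact_mod_cast (by omega : (-(K : ℤ) : ℤ) ≤ 0)
    linarith
  have hc0 : 0 ≤ clock ε₀ (-(K : ℤ)) := clock_nonneg (by linarith) _
  have hsum : |S 1 (-(K : ℤ)) t + ε * S 0 (-(K : ℤ) + 1) t| ≤ A₁ + ε * A₀ := by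
    calc |S 1 (-(K : ℤ)) t + ε * S 0 (-(K : ℤ) + 1) t|
        ≤ |S 1 (-(K : ℤ)) t| + |ε * S 0 (-(K : ℤ) + 1) t| := abs_add_le _ _
      _ = |S 1 (-(K : ℤ)) t| + ε * |S 0 (-(K : ℤ) + 1) t| := by rw [abs_mul, abs_of_nonneg hε]
      _ ≤ A₁ + ε * A₀ := by gcongr
  have hT : |fluxT ε ε₀ S (-(K : ℤ)) t| ≤ A₁ * A₀ * (A₁ + ε * A₀) := by
    unfold fluxT
    rw [abs_mul, abs_mul, abs_mul, abs_of_nonneg hc0]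
    have h12 : |S 1 (-(K : ℤ)) t| * |S 0 (-(K : ℤ) + 1) t| ≤ A₁ * A₀ := mul_le_mul h1 h0 (abs_nonneg _) hA₁
    have hprod : |S 1 (-(K : ℤ)) t| * |S 0 (-(K : ℤ) + 1) t| * |S 1 (-(K : ℤ)) t + ε * S 0 (-(K : ℤ) + 1) t|
        ≤ A₁ * A₀ * (A₁ + ε * A₀) := mul_le_mul h12 hsum (abs_nonneg _) (by positivity)
    calc clock ε₀ (-(K : ℤ)) * |S 1 (-(K : ℤ)) t| * |S 0 (-(K : ℤ) + 1) t|
            * |S 1 (-(K : ℤ)) t + ε * S 0 (-(K : ℤ) + 1) t|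
        = clock ε₀ (-(K : ℤ)) * (|S 1 (-(K : ℤ)) t| * |S 0 (-(K : ℤ) + 1) t|
            * |S 1 (-(K : ℤ)) t + ε * S 0 (-(K : ℤ) + 1) t|) := by ring
      _ ≤ 1 * (A₁ * A₀ * (A₁ + ε * A₀)) := mul_le_mul hc1 hprod (by positivity) zero_le_one
      _ = A₁ * A₀ * (A₁ + ε * A₀) := one_mul _
  calc Real.exp (θ' * ((((-(K : ℤ)) : ℤ) : ℝ) - (-(K : ℝ) + σ * t))) * |fluxT ε ε₀ S (-(K : ℤ)) t|
      ≤ 1 * (A₁ * A₀ * (A₁ + ε * A₀)) := mul_le_mul hw hT (abs_nonneg _) zero_le_one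
    _ = A₁ * A₀ * (A₁ + ε * A₀) := one_mul _

/-! ## The hop with the top input only (L-54e ∘ L-55b) -/

section Hop

variable {ε ε₀ τ κ₂ : ℝ} {S₀ F₀ B₀ : Fin 2 → ℤ → ℝ} {S F : Fin 2 → ℤ → ℝ → ℝ}

/-- **THE (B1) CLAUSE AFTER THE HOP, TOP INPUT ONLY.** Along one exact graded window flow (`0 < ε₀`): the clock-weighted
amplitude bound `A_eff` on every behind bond `n ≤ −K` (rate `0 < μ ≤ σθ′ − 2(1+ε)A_eff sinh(θ′/2)`), a bound `Ē_top` on the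
weighted top-edge flux, initial block energies `≤ V₀` for every block length and ONE budget
`e^{−μτ₁}V₀ + Ē_top(1−e^{−μτ₁})/μ ≤ a²W′` give `BehindEnergyClause K θ′ W′ (recentre S τ₁ a)`. The bottom-edge input of each
block is bounded by the flow's own qualitative a-priori bound times the deep clock and removed by the limit `L → ∞` (L-55b).
[cite: Tao2016AveragedNS, §4 (4.1), (4.3), (4.5), (4.8), §6.3–6.4 (statement shape); route TaoLadderRungTwoFlat, R54-1 (B1), L-54e/L-55b (cell LADDER §54–§55)] -/
theorem behindEnergyClause_hop_topInput
    (hS : PseudoFlowOnShift shiftSetFlat τ ε₀ (mirrorTable ε ε) 0 κ₂ S₀ F₀ B₀ S F)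
    (hε : 0 ≤ ε) (hε₀ : 0 < ε₀) {K : ℕ} {θ' σ τ₁ a Aeff μ Etop V₀ W' : ℝ} (hθ : 0 ≤ θ')
    (hAeff : 0 ≤ Aeff) (hτ₁ : 0 < τ₁) (hτ₁τ : τ₁ ≤ τ) (hστ : σ * τ₁ = 1) (ha : 0 < a)
    (hbd : ∀ t ∈ Ioo 0 τ₁, ∀ n : ℤ, n ≤ -(K : ℤ) →
      clock ε₀ n * |S 1 n t| ≤ Aeff ∧ clock ε₀ n * |S 0 (n + 1) t| ≤ Aeff)
    (hEtop : ∀ t ∈ Ioo 0 τ₁,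
      Real.exp (θ' * ((((-(K : ℤ)) : ℤ) : ℝ) - (-(K : ℝ) + σ * t))) * |fluxT ε ε₀ S (-(K : ℤ)) t| ≤ Etop)
    (hV₀ : ∀ L : ℕ, coMovingEnergyOn (Finset.Icc (1 - (K : ℤ) - L) (-(K : ℤ))) θ' (-(K : ℝ)) S 0 ≤ V₀)
    (hbudget : Real.exp (-μ * τ₁) * V₀ + Etop * (1 - Real.exp (-μ * τ₁)) / μ ≤ a ^ 2 * W')
    (hμ : 0 < μ) (hμle : μ ≤ σ * θ' - 2 * (1 + ε) * Aeff * Real.sinh (θ' / 2)) :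
    BehindEnergyClause K θ' W' (recentre S τ₁ a) := by
  have hσ : 0 < σ := pos_of_mul_pos_left (by rw [hστ]; exact one_pos) hτ₁.le
  have hε₀' : (-1 : ℝ) ≤ ε₀ := by linarith
  -- the flow's own qualitative a-priori bound `Λ` (format clause (4.5)) on `[0, τ]`
  obtain ⟨M, hM⟩ := hS.apriori_S
  have hΛ : ∀ t ∈ Ioo 0 τ₁, ∀ (i : Fin 2) (k : ℤ), |S i k t| ≤ max M 0 := by
    intro t ht i k
    have ht' : t ∈ Icc 0 τ := ⟨ht.1.le, ht.2.le.trans hτ₁τ⟩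
    have h1 := hM t ht' i k
    have hp : 0 < (1 + ε₀) ^ ((10 : ℝ) * k) := Real.rpow_pos_of_pos (by linarith) _
    have h2 : |S i k t| ≤ (1 + (1 + ε₀) ^ ((10 : ℝ) * k)) * |S i k t| :=
      le_mul_of_one_le_left (abs_nonneg _) (by linarith)
    exact (h2.trans h1).trans (le_max_left _ _)
  set Λ : ℝ := max M 0 with hΛdef
  have hΛ0 : 0 ≤ Λ := le_max_right _ _
  have hexp1 : 0 ≤ 1 - Real.exp (-μ * τ₁) := by
    rw [sub_nonneg, Real.exp_le_one_iff]; nlinarith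
  -- the bottom-input coefficient `c` (its value never enters the schedule)
  set c : ℝ := (1 + ε) * Λ ^ 3 * ((1 - Real.exp (-μ * τ₁)) / μ) / a ^ 2 with hcdef
  have hc0 : 0 ≤ c := by positivity
  refine behindEnergyClause_of_vanishing_bottomInput (L₁ := 1) hc0 (fun L => clock ε₀ (1 - (K : ℤ) - L - 1))
    ?_ (clock_bottom_eventually_le hε₀ K)
  intro L hL
  have h1L : (1 : ℤ) ≤ (L : ℤ) := by exact_mod_cast hL
  refine behind_hop_of_pseudoFlow (Ebar := (1 + ε) * Λ ^ 3 * clock ε₀ (1 - (K : ℤ) - L - 1) + Etop)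
    hS hε hε₀' hL hθ hAeff hτ₁ hτ₁τ hστ ha
    (fun t ht n hn => hbd t ht n (Finset.mem_Icc.mp hn).2) ?_ hμ hμle (hV₀ L) ?_
  · -- edge inputs: bottom by the a-priori bound and the deep clock, top by `Ē_top`
    intro t ht
    have hσt : 0 ≤ σ * t := (mul_pos hσ ht.1).le
    have hbot := weighted_bottomFlux_le (θ' := θ') (σ := σ) (K := K) hε hε₀' hθ hL S hσt hΛ0
      (hΛ t ht 1 _) (hΛ t ht 0 _)
    have htop := hEtop t ht
    exact add_le_add hbot htop
  · -- the budget with the extra bottom input `c·η_L` on both sides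
    have hkey : a ^ 2 * (c * clock ε₀ (1 - (K : ℤ) - L - 1))
        = (1 + ε) * Λ ^ 3 * clock ε₀ (1 - (K : ℤ) - L - 1) * (1 - Real.exp (-μ * τ₁)) / μ := by
      rw [hcdef]
      field_simp
    have hsplit : ((1 + ε) * Λ ^ 3 * clock ε₀ (1 - (K : ℤ) - L - 1) + Etop) * (1 - Real.exp (-μ * τ₁)) / μ
        = (1 + ε) * Λ ^ 3 * clock ε₀ (1 - (K : ℤ) - L - 1) * (1 - Real.exp (-μ * τ₁)) / μ
          + Etop * (1 - Real.exp (-μ * τ₁)) / μ := by ring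
    rw [hsplit, mul_add, hkey]
    linarith

/-- **THE BEHIND-ZONE HOP, COMPOSED (top input from the interface amplitudes, start from `H(n)`).** Along one exact graded
window flow with `S(0) = S₀` (`0 < ε₀`, `0 < θ′`): the (B1) clause `BehindEnergyClause K θ′ (W n) z` of the tube state,
its bottom-shell amplitude `a_K`, the kick `|S₀ − z| ≤ r_k` behind, the clock-weighted behind amplitude `A_eff` during the
hop (rate), the interface amplitudes `|v_{−K}| ≤ A₁`, `|a_{1−K}| ≤ A₀` during the hop and the scalar schedule inequality
`e^{−μτ₁}(√(W n + a_K²) + r_k/√(1−e^{−θ′}))² + A₁A₀(A₁+εA₀)(1−e^{−μτ₁})/μ ≤ a²W′` give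
`BehindEnergyClause K θ′ W′ (recentre S τ₁ a)`.
[cite: Tao2016AveragedNS, §4 (4.1), (4.3), (4.5), (4.8), §6.3–6.4 (statement shape); route TaoLadderRungTwoFlat, R54-1 (B1) schedule `W(n+1)` (cell LADDER §54.8, §55.3, L-55a/L-55b)] -/
theorem behindEnergyClause_hop_closed
    (hS : PseudoFlowOnShift shiftSetFlat τ ε₀ (mirrorTable ε ε) 0 κ₂ S₀ F₀ B₀ S F)
    (hε : 0 ≤ ε) (hε₀ : 0 < ε₀) {K : ℕ} {θ' σ τ₁ a Aeff μ A₁ A₀ Wn aK rk W' : ℝ} {z : Fin 2 → ℤ → ℝ}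
    (hθ : 0 < θ') (hAeff : 0 ≤ Aeff) (hτ₁ : 0 < τ₁) (hτ₁τ : τ₁ ≤ τ) (hστ : σ * τ₁ = 1) (ha : 0 < a)
    (hW : BehindEnergyClause K θ' Wn z) (hWn : 0 ≤ Wn) (haK : ∀ i, |z i (-(K : ℤ))| ≤ aK)
    (hkick : ∀ (i : Fin 2) (k : ℤ), k ≤ -(K : ℤ) → |S₀ i k - z i k| ≤ rk) (hrk : 0 ≤ rk)
    (hbd : ∀ t ∈ Ioo 0 τ₁, ∀ n : ℤ, n ≤ -(K : ℤ) →
      clock ε₀ n * |S 1 n t| ≤ Aeff ∧ clock ε₀ n * |S 0 (n + 1) t| ≤ Aeff)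
    (hA₁ : ∀ t ∈ Ioo 0 τ₁, |S 1 (-(K : ℤ)) t| ≤ A₁) (hA₀ : ∀ t ∈ Ioo 0 τ₁, |S 0 (-(K : ℤ) + 1) t| ≤ A₀)
    (hbudget : Real.exp (-μ * τ₁) * (Real.sqrt (Wn + aK ^ 2) + rk / Real.sqrt (1 - Real.exp (-θ'))) ^ 2
        + A₁ * A₀ * (A₁ + ε * A₀) * (1 - Real.exp (-μ * τ₁)) / μ ≤ a ^ 2 * W')
    (hμ : 0 < μ) (hμle : μ ≤ σ * θ' - 2 * (1 + ε) * Aeff * Real.sinh (θ' / 2)) :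
    BehindEnergyClause K θ' W' (recentre S τ₁ a) := by
  have hσ : 0 < σ := pos_of_mul_pos_left (by rw [hστ]; exact one_pos) hτ₁.le
  refine behindEnergyClause_hop_topInput hS hε hε₀ hθ.le hAeff hτ₁ hτ₁τ hστ ha hbd ?_ ?_ hbudget hμ hμle
  · intro t ht
    exact weighted_topFlux_le hε hε₀.le hθ.le K S (mul_pos hσ ht.1).le (hA₁ t ht) (hA₀ t ht)
  · intro L
    exact initial_blockEnergy_le_additive hS.init_S hθ hW hWn haK
      (fun i k hk => hkick i k (Finset.mem_Icc.mp hk).2) hrk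

end Hop

end Summit.NavierStokesRegularity.NavierStokesRegularity.Theorems.HopTube.R54

end
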